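import Literature.NumberTheory.Automorphic.IwasawaDecompositionArchimedean
import Literature.LinearAlgebra.Matrix.UpperTriangularUnitaryEqOne
import Literature.NumberTheory.Automorphic.UnitaryGroupAutomorphicRep
import HarnessLib

/-!
# The archimedean Iwasawa decomposition of the quasi-split unitary group `U(J_N)(ℂ) = B · K∞`,
# `K∞ = U(J_N)(ℂ) ∩ U(N)`, for every `N` (and `𝕜 = ℝ`): existence, uniqueness, compactness of `K∞`

Topic `NumberTheory/Automorphic`; namespace `Literature.NumberTheory.Automorphic.UnitaryGroup`.  THEOREMS
ONLY (no definition, no named fact, no instance, no notation); Mathlib + ★ `IwasawaDecompositionArchimedean` (existence for `GL_N`) + ★ `UpperTriangularUnitaryEqOne` (uniqueness).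
Setting: `RCLike 𝕜`, `σ = starRingEnd 𝕜`, `J_N = (StdForm.antidiagonal N).over 𝕜 = antidiag(1,…,1)` (★
`UnitaryGroupAutomorphicRep`), `G = unitaryGroupOfForm (starRingEnd 𝕜) J_N = {g ∈ GL_N(𝕜) | gᴴ J_N g = J_N}` —
for `𝕜 = ℂ` the real group `U(⌈N/2⌉, ⌊N/2⌋)` (`U(2,1)` for `N = 3`) in coordinates where the upper triangular
elements of `G` form the Borel subgroup `B` (stabiliser of the isotropic flag `⟨e₀⟩ ⊂ ⟨e₀,e₁⟩ ⊂ ⋯`) and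
`K∞ = G ∩ U(N)` is maximal compact.

* §1 the inverse of a `B⁺` matrix (upper triangular, positive real diagonal `d`) is in `B⁺` with diagonal
  `d⁻¹` (`blockTriangular_pos_inv`, over ★ `Literature.LinearAlgebra.Matrix.inv_apply_diag_mul_apply_diag`);
  `B⁺ ∩ U(N) = 1` and the UNIQUENESS of `GL_N(𝕜) = B⁺ · U(N)` are ★ `UpperTriangularUnitaryEqOne`
  (`Literature.LinearAlgebra.Matrix.blockTriangular_mul_unitary_unique`), imported.
* §2 `J_N`: `(J_N X J_N)_{ij} = X_{rev i, rev j}` (conjugation by `J_N` turns lower into upper triangular),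
  `star J_N = J_N ∈ U(N)`, and `g ∈ U(star, J) ↔ (star g) J g = J`.
* §3 **`exists_upperTriangularPos_mul_unitary_of_mem`**: every `g ∈ G` is `g = b k` with `b ∈ G ∩ B⁺`,
  `k ∈ G ∩ U(N)`; subgroup forms `exists_upper_mul_unitary` (`∀ g : G, ∃ b k : G, (↑b).BlockTriangular id ∧
  ↑k ∈ U(N) ∧ g = b * k`, the shape the adelic gluing consumes), `exists_upperPos_mul_unitary`,
  `exists_upper_mul_unitary'` (`star ↑k * ↑k = 1`), `exists_unitary_mul_upper` (`g = k * b`).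
* §4 `isCompact_inter_unitaryGroup`, `isCompact_archCompact`: `K∞` is compact (in `GL_N(𝕜)`, resp. in `G`).

PROOF (the Gram–Schmidt involution trick; Knapp Ch. VI §4: the Iwasawa decomposition of a closed linear
group stable under conjugate transpose is induced from that of `GL_N`).  ★ Gram–Schmidt gives `g = b k`,
`b ∈ B⁺`, `k ∈ U(N)`, uniquely (§1).  `θ(x) = J_N (xᴴ)⁻¹ J_N` fixes exactly `G`, preserves `U(N)` (`J_N` is a
real orthogonal involution) and `B⁺` (`(bᴴ)⁻¹` is lower triangular with diagonal `d⁻¹ > 0`, and `J_N`-conjugation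
reverses rows and columns); so `g = θ(g) = θ(b) θ(k)` is a second decomposition, whence `θ(b) = b`, `θ(k) = k`,
i.e. `b, k ∈ G`.  No flag induction, no signature bookkeeping, every `N` at once.  (Garrett (2018) §3.2
Claim 3.2.1 `G_v = P_v K_v`; Rogawski (1990) §2.2 `G = NAK` at the archimedean place of `U(3)`.)
Written for the cell `pub/hodgecm-mathlib`, ENGINE T1-qs trunk, row H6b-i (archimedean component; consumer:
the adelic gluing `U(J_N)(𝔸_F) = B(𝔸_F) · K`).  HC_CM is proved only modulo the printed citations until
rung 0 closes; this file is unconditional.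

## References
* A. W. Knapp, *Lie Groups Beyond an Introduction*, 2nd ed. (2002), Ch. VI §4, §VI.6 [Knapp2002].
* P. Garrett, *Modern Analysis of Automorphic Forms by Example* (2018), §3.2, Claim 3.2.1 [Garrett2018].
* J. D. Rogawski, *Automorphic Representations of Unitary Groups in Three Variables* (1990), §2.2 p. 13
  [Rogawski1990].
-/

set_option autoImplicit false

noncomputable section

open Matrix
open scoped MatrixGroups ComplexOrder

namespace Literature.NumberTheory.Automorphic

namespace UnitaryGroup

variable {𝕜 : Type*} [RCLike 𝕜] {n : ℕ}

/-! ## §1 The inverse of an upper triangular matrix with positive real diagonal -/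

section UpperPos

/-- The inverse of an upper triangular matrix with positive real diagonal `d` is upper triangular with
positive real diagonal `d⁻¹` (★ `Literature.LinearAlgebra.Matrix.inv_apply_diag_mul_apply_diag`).
[cite: Knapp2002, Ch. VI §4] -/
theorem blockTriangular_pos_inv {b : Matrix (Fin n) (Fin n) 𝕜} {d : Fin n → ℝ}
    (hb : b.BlockTriangular id) (hd : ∀ i, 0 < d i) (hbd : ∀ i, b i i = d i) :
    b⁻¹.BlockTriangular id ∧ (∀ i, 0 < (d i)⁻¹) ∧ ∀ i, b⁻¹ i i = (((d i)⁻¹ : ℝ) : 𝕜) := by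
  have hdet := Literature.LinearAlgebra.Matrix.isUnit_det_of_blockTriangular_of_diag_pos hb
    (fun i => ⟨d i, hd i, hbd i⟩)
  haveI := Matrix.invertibleOfIsUnitDet b hdet
  refine ⟨Matrix.blockTriangular_inv_of_blockTriangular hb, fun i => inv_pos.2 (hd i), fun i => ?_⟩
  have h1 := Literature.LinearAlgebra.Matrix.inv_apply_diag_mul_apply_diag hb hdet i
  rw [hbd i] at h1
  rw [RCLike.ofReal_inv]
  exact eq_inv_of_mul_eq_one_left h1

end UpperPos

/-! ## §2 The form `J_N = antidiag(1, …, 1)` and the involution `x ↦ J_N (xᴴ)⁻¹ J_N` -/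

section Antidiag

variable {R : Type*} [CommRing R]

/-- Entries of `J_N` over `R`. [cite: Rogawski1990, §2.2 p. 13] -/
private theorem antidiag_apply (i j : Fin n) :
    (StdForm.antidiagonal n).over R i j = if j = i.rev then (1 : R) else 0 := by
  simp only [StdForm.over, Matrix.map_apply, StdForm.antidiagonal_J_apply]
  split_ifs <;> simp

/-- `(J_N X) i j = X (rev i) j`. [cite: Rogawski1990, §2.2 p. 13] -/
private theorem antidiagonal_mul_apply (X : Matrix (Fin n) (Fin n) R) (i j : Fin n) :
    ((StdForm.antidiagonal n).over R * X) i j = X i.rev j := by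
  rw [Matrix.mul_apply]
  simp_rw [antidiag_apply, ite_mul, one_mul, zero_mul]
  rw [Finset.sum_ite_eq' Finset.univ i.rev, if_pos (Finset.mem_univ _)]

/-- `(X J_N) i j = X i (rev j)`. [cite: Rogawski1990, §2.2 p. 13] -/
private theorem mul_antidiagonal_apply (X : Matrix (Fin n) (Fin n) R) (i j : Fin n) :
    (X * (StdForm.antidiagonal n).over R) i j = X i j.rev := by
  rw [Matrix.mul_apply]
  simp_rw [antidiag_apply, mul_ite, mul_one, mul_zero]
  have h : ∀ x : Fin n, (j = x.rev) ↔ (x = j.rev) := fun x =>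
    ⟨fun h => by rw [h, Fin.rev_rev], fun h => by rw [h, Fin.rev_rev]⟩
  simp_rw [h]
  rw [Finset.sum_ite_eq' Finset.univ j.rev, if_pos (Finset.mem_univ _)]

/-- `(J_N X J_N) i j = X (rev i) (rev j)` — conjugation by `J_N` reverses rows and columns.
[cite: Rogawski1990, §2.2 p. 13] -/
theorem antidiagonal_mul_mul_antidiagonal_apply (X : Matrix (Fin n) (Fin n) R) (i j : Fin n) :
    ((StdForm.antidiagonal n).over R * X * (StdForm.antidiagonal n).over R) i j = X i.rev j.rev := by
  rw [mul_antidiagonal_apply, antidiagonal_mul_apply]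

/-- Conjugation by `J_N` turns LOWER triangular matrices into UPPER triangular ones, reversing the
diagonal. [cite: Knapp2002, Ch. VI §4] -/
theorem blockTriangular_antidiagonal_conj_of_lower {X : Matrix (Fin n) (Fin n) R}
    (hX : ∀ i j : Fin n, i < j → X i j = 0) :
    ((StdForm.antidiagonal n).over R * X * (StdForm.antidiagonal n).over R).BlockTriangular id ∧
      ∀ i, ((StdForm.antidiagonal n).over R * X * (StdForm.antidiagonal n).over R) i i = X i.rev i.rev := by
  refine ⟨fun i j hij => ?_, fun i => antidiagonal_mul_mul_antidiagonal_apply X i i⟩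
  rw [antidiagonal_mul_mul_antidiagonal_apply]
  exact hX _ _ (Fin.rev_lt_rev.2 hij)

/-- `star J_N = J_N` (real symmetric). [cite: Rogawski1990, §2.2 p. 13] -/
theorem star_antidiagonal_over [StarRing R] :
    star ((StdForm.antidiagonal n).over R) = (StdForm.antidiagonal n).over R := by
  rw [Matrix.star_eq_conjTranspose, Matrix.conjTranspose, StdForm.transpose_over, StdForm.over_map_star]

/-- `J_N ∈ U(N)` (a real orthogonal involution). [cite: Rogawski1990, §2.2 p. 13] -/
theorem antidiagonal_over_mem_unitaryGroup [StarRing R] :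
    (StdForm.antidiagonal n).over R ∈ Matrix.unitaryGroup (Fin n) R := by
  rw [Matrix.mem_unitaryGroup_iff, star_antidiagonal_over, StdForm.over_mul_over]

/-- Membership in `U(σ, J)` for `σ = starRingEnd`: `g ∈ U(star, J) ↔ (star g) J g = J`
(`(g.map star)ᵀ = gᴴ = star g`). [cite: Rogawski1990, §2.2 p. 13] -/
theorem mem_unitaryGroupOfForm_starRingEnd_iff [StarRing R] {J : Matrix (Fin n) (Fin n) R}
    {g : GL (Fin n) R} :
    g ∈ unitaryGroupOfForm (starRingEnd R) J ↔
      star (g : Matrix (Fin n) (Fin n) R) * J * (g : Matrix (Fin n) (Fin n) R) = J := by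
  rw [mem_unitaryGroupOfForm_iff]
  have h : ((g : Matrix (Fin n) (Fin n) R).map (starRingEnd R))ᵀ = star (g : Matrix (Fin n) (Fin n) R) := by
    ext i j
    rw [Matrix.transpose_apply, Matrix.map_apply, Matrix.star_apply, starRingEnd_apply]
  rw [h]

end Antidiag

/-! ## §3 The Iwasawa decomposition `U(J_N)(𝕜) = B⁺ · K∞` -/

section Iwasawa

/-- **`U(J_N)(𝕜) = B⁺ · K∞` (archimedean Iwasawa decomposition of the quasi-split unitary group,
`GL`-form with the positive diagonal)**: every `g ∈ G = U(star, J_N)(𝕜)` is `g = b k` with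
`b, k ∈ G`, `b` upper triangular with positive real diagonal `d` and `k ∈ U(N)` (so `k ∈ K∞ = G ∩ U(N)`).
Proof: the `GL_N` decomposition `g = b k` (★ Gram–Schmidt) and its image under
`x ↦ J_N (xᴴ)⁻¹ J_N`, which fixes `g`, are two `B⁺ · U(N)` decompositions of `g`; by uniqueness they
coincide, so `b` and `k` are fixed, i.e. lie in `G`. [cite: Knapp2002, Ch. VI §4]
[cite: Garrett2018, §3.2 Claim 3.2.1] [cite: Rogawski1990, §2.2 p. 13] -/
theorem exists_upperTriangularPos_mul_unitary_of_mem {g : GL (Fin n) 𝕜}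
    (hg : g ∈ unitaryGroupOfForm (starRingEnd 𝕜) ((StdForm.antidiagonal n).over 𝕜)) :
    ∃ (b k : GL (Fin n) 𝕜) (d : Fin n → ℝ),
      b ∈ unitaryGroupOfForm (starRingEnd 𝕜) ((StdForm.antidiagonal n).over 𝕜) ∧
      k ∈ unitaryGroupOfForm (starRingEnd 𝕜) ((StdForm.antidiagonal n).over 𝕜) ∧
      (b : Matrix (Fin n) (Fin n) 𝕜).BlockTriangular id ∧ (∀ i, 0 < d i) ∧
      (∀ i, (b : Matrix (Fin n) (Fin n) 𝕜) i i = d i) ∧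
      (k : Matrix (Fin n) (Fin n) 𝕜) ∈ Matrix.unitaryGroup (Fin n) 𝕜 ∧ g = b * k := by
  obtain ⟨b, k, d, hb, hd, hbd, hk, hgbk⟩ :=
    Matrix.GeneralLinearGroup.exists_upperTriangularPos_mul_unitary g
  -- notation
  set J : Matrix (Fin n) (Fin n) 𝕜 := (StdForm.antidiagonal n).over 𝕜 with hJ
  set B : Matrix (Fin n) (Fin n) 𝕜 := (b : Matrix (Fin n) (Fin n) 𝕜) with hB
  set K : Matrix (Fin n) (Fin n) 𝕜 := (k : Matrix (Fin n) (Fin n) 𝕜) with hK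
  have hJJ : J * J = 1 := StdForm.over_mul_over _ 𝕜
  have hJs : star J = J := star_antidiagonal_over
  have hgm : (g : Matrix (Fin n) (Fin n) 𝕜) = B * K := by rw [hgbk, Units.val_mul]
  have hG : star (g : Matrix (Fin n) (Fin n) 𝕜) * J * (g : Matrix (Fin n) (Fin n) 𝕜) = J :=
    mem_unitaryGroupOfForm_starRingEnd_iff.1 hg
  have hdetB := Literature.LinearAlgebra.Matrix.isUnit_det_of_blockTriangular_of_diag_pos hb
    (fun i => ⟨d i, hd i, hbd i⟩)
  have hKK : K * star K = 1 := Matrix.mem_unitaryGroup_iff.1 hk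
  have hKK' : star K * K = 1 := Matrix.mem_unitaryGroup_iff'.1 hk
  -- the two inverses of `g`: `J (star g) J` and `(star K) B⁻¹`
  have hinv1 : (J * star (g : Matrix (Fin n) (Fin n) 𝕜) * J) * (g : Matrix (Fin n) (Fin n) 𝕜) = 1 := by
    rw [Matrix.mul_assoc, Matrix.mul_assoc, ← Matrix.mul_assoc (star _), hG, hJJ]
  have hinv2 : (g : Matrix (Fin n) (Fin n) 𝕜) * (star K * B⁻¹) = 1 := by
    rw [hgm, Matrix.mul_assoc, ← Matrix.mul_assoc K, hKK, Matrix.one_mul, Matrix.mul_nonsing_inv B hdetB]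
  have hinv_eq : J * star (g : Matrix (Fin n) (Fin n) 𝕜) * J = star K * B⁻¹ := by
    rw [← Matrix.inv_eq_left_inv hinv1, Matrix.inv_eq_right_inv hinv2]
  -- apply `star`: `J g J = star (B⁻¹) * K`
  have hstar : J * (g : Matrix (Fin n) (Fin n) 𝕜) * J = star B⁻¹ * K := by
    have h := congrArg star hinv_eq
    rw [star_mul, star_mul, star_star, hJs, star_mul, star_star, ← Matrix.mul_assoc] at h
    exact h
  -- the second decomposition `g = B' K'`, `B' = J (star B⁻¹) J`, `K' = J K J`
  obtain ⟨B', hB'⟩ : ∃ B' : Matrix (Fin n) (Fin n) 𝕜, B' = J * star B⁻¹ * J := ⟨_, rfl⟩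
  obtain ⟨K', hK'⟩ : ∃ K' : Matrix (Fin n) (Fin n) 𝕜, K' = J * K * J := ⟨_, rfl⟩
  have hdec : B' * K' = B * K := by
    rw [hB', hK', ← hgm]
    calc J * star B⁻¹ * J * (J * K * J) = J * (star B⁻¹ * (J * J) * K) * J := by
          simp only [Matrix.mul_assoc]
      _ = J * (J * (g : Matrix (Fin n) (Fin n) 𝕜) * J) * J := by rw [hJJ, Matrix.mul_one, hstar]
      _ = (J * J) * (g : Matrix (Fin n) (Fin n) 𝕜) * (J * J) := by simp only [Matrix.mul_assoc]
      _ = (g : Matrix (Fin n) (Fin n) 𝕜) := by rw [hJJ, Matrix.one_mul, Matrix.mul_one]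
  -- `B' ∈ B⁺`
  obtain ⟨hBi, hdi, hBdi⟩ := blockTriangular_pos_inv hb hd hbd
  have hlow : ∀ i j : Fin n, i < j → (star B⁻¹) i j = 0 := fun i j hij => by
    rw [Matrix.star_apply, hBi hij, star_zero]
  obtain ⟨hB'up, hB'diag⟩ := blockTriangular_antidiagonal_conj_of_lower hlow
  rw [← hB'] at hB'up hB'diag
  have hB'd : ∀ i, B' i i = (((d i.rev)⁻¹ : ℝ) : 𝕜) := fun i => by
    rw [hB'diag i, Matrix.star_apply, hBdi, RCLike.star_def, RCLike.conj_ofReal]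
  -- `K' ∈ U(N)`
  have hK'u : K' ∈ Matrix.unitaryGroup (Fin n) 𝕜 := by
    rw [hK']
    exact mul_mem (mul_mem antidiagonal_over_mem_unitaryGroup hk) antidiagonal_over_mem_unitaryGroup
  -- uniqueness: `B' = B`, `K' = K`
  obtain ⟨hBB, hKK2⟩ := Literature.LinearAlgebra.Matrix.blockTriangular_mul_unitary_unique hB'up hb
    (fun i => ⟨(d i.rev)⁻¹, hdi i.rev, hB'd i⟩) (fun i => ⟨d i, hd i, hbd i⟩) hK'u hk hdec
  -- hence `b, k ∈ G`
  refine ⟨b, k, d, ?_, ?_, hb, hd, hbd, hk, hgbk⟩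
  · rw [mem_unitaryGroupOfForm_starRingEnd_iff]
    -- `star B = J B⁻¹ J` since `B = J (star B⁻¹) J`
    have hsB : star B = J * (B⁻¹ * J) := by
      calc star B = star B' := by rw [hBB]
        _ = J * (B⁻¹ * J) := by rw [hB', star_mul, star_mul, star_star, hJs]
    change star B * J * B = J
    rw [hsB]
    simp only [Matrix.mul_assoc]
    rw [← Matrix.mul_assoc J J B, hJJ, Matrix.one_mul, Matrix.nonsing_inv_mul B hdetB, Matrix.mul_one]
  · rw [mem_unitaryGroupOfForm_starRingEnd_iff]
    change star K * J * K = J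
    calc star K * J * K = star K * J * K' := by rw [hKK2]
      _ = star K * (J * J) * K * J := by rw [hK']; simp only [Matrix.mul_assoc]
      _ = J := by rw [hJJ, Matrix.mul_one, hKK', Matrix.one_mul]

/-- **`U(J_N)(𝕜) = B · K∞`, subgroup form** (the shape consumed by the adelic gluing): for every
element `g` of `G = U(star, J_N)(𝕜)` there are `b k : G` with `↑b` upper triangular,
`↑k ∈ U(N)` and `g = b * k`. [cite: Knapp2002, Ch. VI §4] [cite: Garrett2018, §3.2 Claim 3.2.1]
[cite: Rogawski1990, §2.2 p. 13] -/
theorem exists_upper_mul_unitary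
    (g : unitaryGroupOfForm (starRingEnd 𝕜) ((StdForm.antidiagonal n).over 𝕜)) :
    ∃ b k : unitaryGroupOfForm (starRingEnd 𝕜) ((StdForm.antidiagonal n).over 𝕜),
      ((b : GL (Fin n) 𝕜) : Matrix (Fin n) (Fin n) 𝕜).BlockTriangular id ∧
      ((k : GL (Fin n) 𝕜) : Matrix (Fin n) (Fin n) 𝕜) ∈ Matrix.unitaryGroup (Fin n) 𝕜 ∧ g = b * k := by
  obtain ⟨b, k, d, hbG, hkG, hb, -, -, hk, hg⟩ := exists_upperTriangularPos_mul_unitary_of_mem g.2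
  exact ⟨⟨b, hbG⟩, ⟨k, hkG⟩, hb, hk, Subtype.ext hg⟩

/-- **`U(J_N)(𝕜) = B⁺ · K∞`, subgroup form with the positive diagonal** (the refinement used for
Siegel sets and for the uniqueness of the Iwasawa coordinates). [cite: Knapp2002, Ch. VI §4]
[cite: Garrett2018, §3.2 Claim 3.2.1] -/
theorem exists_upperPos_mul_unitary
    (g : unitaryGroupOfForm (starRingEnd 𝕜) ((StdForm.antidiagonal n).over 𝕜)) :
    ∃ (b k : unitaryGroupOfForm (starRingEnd 𝕜) ((StdForm.antidiagonal n).over 𝕜)) (d : Fin n → ℝ),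
      ((b : GL (Fin n) 𝕜) : Matrix (Fin n) (Fin n) 𝕜).BlockTriangular id ∧ (∀ i, 0 < d i) ∧
      (∀ i, ((b : GL (Fin n) 𝕜) : Matrix (Fin n) (Fin n) 𝕜) i i = d i) ∧
      ((k : GL (Fin n) 𝕜) : Matrix (Fin n) (Fin n) 𝕜) ∈ Matrix.unitaryGroup (Fin n) 𝕜 ∧ g = b * k := by
  obtain ⟨b, k, d, hbG, hkG, hb, hd, hbd, hk, hg⟩ := exists_upperTriangularPos_mul_unitary_of_mem g.2
  exact ⟨⟨b, hbG⟩, ⟨k, hkG⟩, d, hb, hd, hbd, hk, Subtype.ext hg⟩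

/-- **`U(J_N)(𝕜) = B · K∞` with the compact condition spelled `star k · k = 1`** (the T1-qs trunk's
currency `K∞ := {k ∈ G | star ↑k * ↑k = 1}`). [cite: Rogawski1990, §2.2 p. 13] [cite: Knapp2002, Ch. VI §4] -/
theorem exists_upper_mul_unitary'
    (g : unitaryGroupOfForm (starRingEnd 𝕜) ((StdForm.antidiagonal n).over 𝕜)) :
    ∃ b k : unitaryGroupOfForm (starRingEnd 𝕜) ((StdForm.antidiagonal n).over 𝕜),
      star ((k : GL (Fin n) 𝕜) : Matrix (Fin n) (Fin n) 𝕜) * ((k : GL (Fin n) 𝕜) : Matrix (Fin n) (Fin n) 𝕜) = 1 ∧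
      ((b : GL (Fin n) 𝕜) : Matrix (Fin n) (Fin n) 𝕜).BlockTriangular id ∧ g = b * k := by
  obtain ⟨b, k, hb, hk, hg⟩ := exists_upper_mul_unitary g
  exact ⟨b, k, Matrix.mem_unitaryGroup_iff'.1 hk, hb, hg⟩

/-- **`U(J_N)(𝕜) = K∞ · B`** (the other order, from the decomposition of `g⁻¹`: the inverse of an
upper triangular element of `G` is upper triangular, the inverse of a unitary one unitary).
[cite: Knapp2002, Ch. VI §4] [cite: Rogawski1990, §2.2 p. 13] -/
theorem exists_unitary_mul_upper
    (g : unitaryGroupOfForm (starRingEnd 𝕜) ((StdForm.antidiagonal n).over 𝕜)) :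
    ∃ k b : unitaryGroupOfForm (starRingEnd 𝕜) ((StdForm.antidiagonal n).over 𝕜),
      ((k : GL (Fin n) 𝕜) : Matrix (Fin n) (Fin n) 𝕜) ∈ Matrix.unitaryGroup (Fin n) 𝕜 ∧
      ((b : GL (Fin n) 𝕜) : Matrix (Fin n) (Fin n) 𝕜).BlockTriangular id ∧ g = k * b := by
  obtain ⟨b, k, d, hbG, hkG, hb, hd, hbd, hk, hg⟩ := exists_upperTriangularPos_mul_unitary_of_mem (g⁻¹).2
  refine ⟨⟨k, hkG⟩⁻¹, ⟨b, hbG⟩⁻¹, ?_, ?_, ?_⟩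
  · -- `↑(k⁻¹) = star k ∈ U(N)`
    have h : (((⟨k, hkG⟩⁻¹ : unitaryGroupOfForm (starRingEnd 𝕜) ((StdForm.antidiagonal n).over 𝕜)) :
        GL (Fin n) 𝕜) : Matrix (Fin n) (Fin n) 𝕜) = (k : Matrix (Fin n) (Fin n) 𝕜)⁻¹ := by
      rw [Subgroup.coe_inv, Matrix.coe_units_inv]
    rw [h, Matrix.inv_eq_right_inv (Matrix.mem_unitaryGroup_iff.1 hk)]
    exact Unitary.star_mem hk
  · have h : (((⟨b, hbG⟩⁻¹ : unitaryGroupOfForm (starRingEnd 𝕜) ((StdForm.antidiagonal n).over 𝕜)) :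
        GL (Fin n) 𝕜) : Matrix (Fin n) (Fin n) 𝕜) = (b : Matrix (Fin n) (Fin n) 𝕜)⁻¹ := by
      rw [Subgroup.coe_inv, Matrix.coe_units_inv]
    rw [h]
    exact (blockTriangular_pos_inv hb hd hbd).1
  · rw [← _root_.mul_inv_rev, ← inv_eq_iff_eq_inv]
    exact Subtype.ext (by rw [Subgroup.coe_mul]; exact hg)

end Iwasawa

/-! ## §4 `K∞ = U(J_N)(𝕜) ∩ U(N)` is compact -/

section Compact

/-- The inclusion `U(N) → GL_N(𝕜)`, `k ↦ (k, star k)`, is continuous for the unit-group topology.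
[cite: Garrett2018, §3.2] -/
theorem continuous_unitary_toUnits :
    Continuous (Unitary.toUnits : Matrix.unitaryGroup (Fin n) 𝕜 → GL (Fin n) 𝕜) := by
  refine Units.continuous_iff.2 ⟨continuous_subtype_val, ?_⟩
  have h : (fun x : Matrix.unitaryGroup (Fin n) 𝕜 => ((Unitary.toUnits x)⁻¹ : GL (Fin n) 𝕜).val) =
      fun x : Matrix.unitaryGroup (Fin n) 𝕜 => star (x : Matrix (Fin n) (Fin n) 𝕜) := by
    funext x; rfl
  rw [h]
  exact continuous_subtype_val.star

/-- `{g ∈ GL_N(𝕜) | ↑g ∈ U(N)}` is compact (the continuous image of the compact `U(N)`,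
★ `Matrix.isCompact_unitaryGroup`). [cite: Garrett2018, §3.2] -/
theorem isCompact_setOf_coe_mem_unitaryGroup :
    IsCompact {g : GL (Fin n) 𝕜 | (g : Matrix (Fin n) (Fin n) 𝕜) ∈ Matrix.unitaryGroup (Fin n) 𝕜} := by
  have hK : IsCompact (Set.univ : Set (Matrix.unitaryGroup (Fin n) 𝕜)) :=
    isCompact_iff_isCompact_univ.1 Matrix.isCompact_unitaryGroup
  have himage : (Unitary.toUnits : Matrix.unitaryGroup (Fin n) 𝕜 → GL (Fin n) 𝕜) '' Set.univ =
      {g : GL (Fin n) 𝕜 | (g : Matrix (Fin n) (Fin n) 𝕜) ∈ Matrix.unitaryGroup (Fin n) 𝕜} := by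
    ext g
    simp only [Set.image_univ, Set.mem_range, Set.mem_setOf_eq]
    constructor
    · rintro ⟨x, rfl⟩; exact x.2
    · intro hg; exact ⟨⟨(g : Matrix (Fin n) (Fin n) 𝕜), hg⟩, Units.ext rfl⟩
  rw [← himage]
  exact hK.image continuous_unitary_toUnits

/-- `G = U(star, J)(𝕜)` is closed in `GL_N(𝕜)`. [cite: Garrett2018, §3.2] -/
theorem isClosed_unitaryGroupOfForm_starRingEnd (J : Matrix (Fin n) (Fin n) 𝕜) :
    IsClosed (unitaryGroupOfForm (starRingEnd 𝕜) J : Set (GL (Fin n) 𝕜)) := by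
  have h : (unitaryGroupOfForm (starRingEnd 𝕜) J : Set (GL (Fin n) 𝕜)) =
      (fun g : GL (Fin n) 𝕜 => star (g : Matrix (Fin n) (Fin n) 𝕜) * J * (g : Matrix (Fin n) (Fin n) 𝕜)) ⁻¹' {J} := by
    ext g
    rw [SetLike.mem_coe, mem_unitaryGroupOfForm_starRingEnd_iff, Set.mem_preimage, Set.mem_singleton_iff]
  rw [h]
  refine IsClosed.preimage ?_ isClosed_singleton
  exact ((Units.continuous_val.star.mul continuous_const).mul Units.continuous_val)

/-- **`K∞ = U(J_N)(𝕜) ∩ U(N)` is compact** as a subset of `GL_N(𝕜)` (closed `G` ∩ compact `U(N)`).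
[cite: Garrett2018, §3.2] [cite: Knapp2002, Ch. VI §4] -/
theorem isCompact_inter_unitaryGroup :
    IsCompact ((unitaryGroupOfForm (starRingEnd 𝕜) ((StdForm.antidiagonal n).over 𝕜) : Set (GL (Fin n) 𝕜)) ∩
      {g : GL (Fin n) 𝕜 | (g : Matrix (Fin n) (Fin n) 𝕜) ∈ Matrix.unitaryGroup (Fin n) 𝕜}) :=
  (isCompact_setOf_coe_mem_unitaryGroup.inter_left (isClosed_unitaryGroupOfForm_starRingEnd _))

/-- **`K∞` is compact as a subset of the group `G = U(J_N)(𝕜)`** (subspace topology).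
[cite: Garrett2018, §3.2] [cite: Knapp2002, Ch. VI §4] -/
theorem isCompact_archCompact :
    IsCompact {k : unitaryGroupOfForm (starRingEnd 𝕜) ((StdForm.antidiagonal n).over 𝕜) |
      ((k : GL (Fin n) 𝕜) : Matrix (Fin n) (Fin n) 𝕜) ∈ Matrix.unitaryGroup (Fin n) 𝕜} := by
  rw [Topology.IsEmbedding.subtypeVal.isCompact_iff]
  convert (isCompact_inter_unitaryGroup (𝕜 := 𝕜) (n := n)) using 1
  ext g
  simp only [Set.mem_image, Set.mem_setOf_eq, Set.mem_inter_iff, SetLike.mem_coe]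
  constructor
  · rintro ⟨k, hk, rfl⟩; exact ⟨k.2, hk⟩
  · rintro ⟨hg, hk⟩; exact ⟨⟨g, hg⟩, hk, rfl⟩

end Compact

end UnitaryGroup

end Literature.NumberTheory.Automorphic
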